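import Mathlib
import HarnessLib
import Summits.ResolutionOfSingularities.ResolutionOfSingularities.Theorems.HomologicalConductorNoZenoCALayerAssembly

/-!
# Crux `NoZenoR` / `NoZeno` (stmt-ResolutionOfSingularities-19943 / -16483), line
# `sandwich-cluster`, S3 Layer 2 — CA-layer IV: DUALS OF HIGH SYZYGIES (the (W)-rider)

Route `ResolutionOfSingularities/HomologicalConductor`.  OURS (cell res-hironaka, crux chain W4.4,
seat res-L0-w44-stub-5 = res-D-pv-037); nothing here is a statement of the manuscript under review
(Hironaka 2017); AI-written, weaker than expert review.

THEOREM A (G4′, `stub_skyPrincipal`) reads the cohomology annihilator as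
`caⁿ(T) = ⋂ s̲ann(L*)` over the duals `L*` of the `(n-1)`-st syzygies `L` of finitely generated
modules (CA4 = CA1 + CA0 + CA3: files `…StableAnnihilatorReduction`, `…ReflexiveSyzygy`,
`…CALayerAssembly`), and then feeds each `M′ := L*` to the G-layer, whose input (W) of the full-sheaf package G2(vii)
is `Ext¹_T(M′, T) = 0`.  That vanishing is CA2 ([Iyama–Wemyss 2.7 (e)⇒(d)] without completeness,
res-D-pv-043's `ext_one_eq_zero_of_dual_syzygy_of_reflexive`) applied to `X := L*`, whose hypotheses
are: `X` finitely generated reflexive, and an exact `0 → X* → P → Y → 0` with `P` finitely generated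
free and `Y` finitely generated reflexive.  By tri-1's audit (TRIAGE v4 §7 F1) this «(W)-rider» holds
for `n ≥ 4` only (at `n = 3`, `1/3(1,1)`: `L = S₁`, `L* = S₂`, `Ext¹(S₂,T) ≠ 0`), i.e. for `L` an
`s`-th syzygy with `s ≥ 3`.  This file discharges the rider's CA-side content, CA2-free:

* `isSyzygy_add_iff` — peeling `Ω^{s+t} M = Ωˢ(Ωᵗ M)` (any commutative ring);
* `isReflexive_dual_of_isSyzygy` — over a domain the dual `L*` of an `s`-th syzygy with `s ≥ 2` is
  reflexive (stub-7's `isReflexive_of_isSyzygy_of_two_le` = CA0 after peeling, then Mathlib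
  `Module.Dual.instIsReflecive`);
* `finite_dual` — the dual of a finitely generated module over a noetherian ring is finitely
  generated (`K* ↪ (Tᵐ)*`);
* **`exists_extVanishingInput_dual_of_isSyzygy`** — for `T` a noetherian LOCAL domain, `M` finitely
  generated and `L` an `(s+1)`-th syzygy of `M` with `s ≥ 2`: the defining sequence
  `0 → L → P → Ωˢ M → 0` IS the sequence CA2 wants for `X := L*` — `L ≅ L** = X*`
  (`Module.evalEquiv`, `L` reflexive), `P` finitely generated projective hence FREE (local ring,
  Mathlib `Module.free_of_flat_of_isLocalRing`), `Y = Ωˢ M` finitely generated (noetherian) and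
  reflexive (`s ≥ 2`).

With CA2 in the tree, `Ext¹_T(L*, T) = 0` for every such `L` is the three-line composition recorded
at the end of this docstring (to be appended here, or inlined in the lead's G4′ assembly):
`obtain ⟨S, hS, e₁, _, _, _, hY, -⟩ := exists_extVanishingInput_dual_of_isSyzygy hs hM hL;
 exact ext_one_eq_zero_of_dual_syzygy_of_reflexive hdim (.of T (Dual T L)) (isReflexive_dual…) S hS e₁ hY e`.

References: O. Iyama, M. Wemyss, *The classification of special Cohen–Macaulay modules*,
Math. Z. 265 (2010), Thm. 2.7 [arXiv:0809.1958]; W. Bruns, J. Herzog, *Cohen–Macaulay rings*,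
Prop. 1.4.1 [`BrunsHerzog1993`].
-/

noncomputable section

-- single-problem summit: the doubled namespace component `ResolutionOfSingularities` is forced
set_option linter.dupNamespace false

namespace Summit.ResolutionOfSingularities.ResolutionOfSingularities.Theorems.NoZeno.SandwichCluster

open CategoryTheory CategoryTheory.Abelian Literature.RingTheory.CohomologyAnnihilator

universe u

variable {T : Type u} [CommRing T]

/-! ## Peeling syzygy chains -/

/-- Peeling a syzygy chain at any height: `K` is an `(s+t)`-th syzygy of `M` iff it is an `s`-th
syzygy of a `t`-th syzygy of `M` (`⇐` is the tree's `IsSyzygy.trans`; `⇒` by induction on `s`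
along the defining sequences `0 → Ωⁱ⁺¹ → P → Ωⁱ → 0`). [folklore] -/
theorem isSyzygy_add_iff {M K : ModuleCat.{u} T} {s t : ℕ} :
    IsSyzygy (s + t) M K ↔ ∃ M' : ModuleCat.{u} T, IsSyzygy t M M' ∧ IsSyzygy s M' K := by
  constructor
  · induction s generalizing K with
    | zero =>
      intro h
      rw [Nat.zero_add] at h
      exact ⟨K, h, ⟨Iso.refl K⟩⟩
    | succ s ih =>
      intro h
      rw [Nat.add_right_comm] at h
      obtain ⟨K', P, hK', hP, hproj, f, g, w, hS⟩ := h
      obtain ⟨M', ht, hs⟩ := ih hK'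
      exact ⟨M', ht, K', P, hs, hP, hproj, f, g, w, hS⟩
  · rintro ⟨M', ht, hs⟩
    exact ht.trans hs

/-! ## High syzygies and their duals are reflexive -/

/-- The dual `K* = Hom_T(K, T)` of an `s`-th syzygy module, `s ≥ 2`, over a domain is reflexive (the
dual of a reflexive module is reflexive, Mathlib `Module.Dual.instIsReflecive`). [folklore] -/
theorem isReflexive_dual_of_isSyzygy [IsDomain T] {s : ℕ} (hs : 2 ≤ s) {M K : ModuleCat.{u} T}
    (hK : IsSyzygy s M K) : Module.IsReflexive T (Module.Dual T K) := by
  haveI := isReflexive_of_isSyzygy_of_two_le hs hK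
  infer_instance

/-- The dual of a finitely generated module over a noetherian ring is finitely generated: a
surjection `Tᵐ ↠ K` dualises to an injection `K* ↪ (Tᵐ)*` into a finitely generated module.
[folklore] -/
theorem finite_dual [IsNoetherianRing T] (K : Type u) [AddCommGroup K] [Module T K]
    [Module.Finite T K] : Module.Finite T (Module.Dual T K) := by
  obtain ⟨m, f, hf⟩ := Module.Finite.exists_fin' T K
  exact Module.Finite.of_injective f.dualMap (LinearMap.dualMap_injective_of_surjective hf)

/-- Over a noetherian ring, the dual of a syzygy module of a finitely generated module is finitely
generated. [folklore] -/
theorem finite_dual_of_isSyzygy [IsNoetherianRing T] {s : ℕ} {M K : ModuleCat.{u} T}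
    (hM : Module.Finite T M) (hK : IsSyzygy s M K) : Module.Finite T (Module.Dual T K) :=
  haveI := finite_of_isSyzygy s hM hK
  finite_dual K

/-! ## The (W)-rider: `L*` meets the hypotheses of CA2 for `L ∈ Ω^{≥ 3}(mod T)` -/

/-- Over a LOCAL ring a finitely generated projective module is free
(Mathlib `Module.free_of_flat_of_isLocalRing`). [folklore] -/
theorem free_of_finite_of_projective [IsLocalRing T] (P : ModuleCat.{u} T) (hP : Module.Finite T P)
    (hproj : Projective P) : Module.Free T P := by
  haveI := hP
  haveI : Module.Projective T P := moduleProjective_of_projective P hproj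
  exact Module.free_of_flat_of_isLocalRing

/-- **The (W)-rider, CA2-free part.**  Let `T` be a noetherian local domain, `M` finitely generated
and `L` an `(s+1)`-th syzygy of `M` with `s ≥ 2` (so `L ∈ Ω^{≥ 3}(mod T)`; `n - 1 = s + 1 ≥ 3`,
i.e. `n ≥ 4`, in the numbering of CA4 / tri-1 F1).  Then the defining sequence
`S : 0 → L → P → Ωˢ M → 0` satisfies, for `X := L*`, every hypothesis of CA2
(`ext_one_eq_zero_of_dual_syzygy_of_reflexive`): `S.X₁ = L ≅ L** = X*` (`L` is reflexive),
`S.X₂ = P` is finitely generated FREE, `S.X₃ = Ωˢ M` is finitely generated REFLEXIVE — together with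
`Module.Finite T X` (`finite_dual_of_isSyzygy`) and `Module.IsReflexive T X`
(`isReflexive_dual_of_isSyzygy`).  Hence, by CA2 over a two-dimensional normal `T`,
`Ext¹_T(L*, T) = 0` — the input (W) of the full-sheaf package G2(vii). [folklore] -/
theorem exists_extVanishingInput_dual_of_isSyzygy [IsNoetherianRing T] [IsLocalRing T] [IsDomain T]
    {s : ℕ} (hs : 2 ≤ s) {M L : ModuleCat.{u} T} (hM : Module.Finite T M)
    (hL : IsSyzygy (s + 1) M L) :
    ∃ (S : ShortComplex (ModuleCat.{u} T)) (_ : S.ShortExact)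
      (_ : S.X₁ ≅ ModuleCat.of T (Module.Dual T (ModuleCat.of T (Module.Dual T L))))
      (_ : Module.Finite T S.X₂) (_ : Module.Free T S.X₂) (_ : Module.Finite T S.X₃),
      Module.IsReflexive T S.X₃ ∧ IsSyzygy s M S.X₃ := by
  obtain ⟨K', P, hK', hPfin, hPproj, f, g, w, hS⟩ := hL
  haveI : Module.IsReflexive T L :=
    isReflexive_of_isSyzygy_of_two_le (s := s + 1) (by omega) ⟨K', P, hK', hPfin, hPproj, f, g, w, hS⟩
  haveI : Module.Finite T K' := finite_of_isSyzygy s hM hK'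
  exact ⟨ShortComplex.mk f g w, hS, (Module.evalEquiv T L).toModuleIso, hPfin,
    free_of_finite_of_projective P hPfin hPproj, inferInstance,
    isReflexive_of_isSyzygy_of_two_le hs hK', hK'⟩

end Summit.ResolutionOfSingularities.ResolutionOfSingularities.Theorems.NoZeno.SandwichCluster

end
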